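/-
Copyright (c) 2026 the pub-hodgecm-mathlib formalisation cell (harness21).  Prover seat hodgecm-mathlib-K2E5-p16 (g5): Track B «K2-LIT»,
hLiu418 = stmt-HodgeConjecture-24832, ROAD Φ organ Φ6b-6 (β-shift of Shimura's `η` on `Herm₂(ℂ)`), file (1): DEFS leaf; 2026-09-04.
-/
import Summits.HodgeConjecture.HodgeConjecture.Theorems.K2LiuHermTwoEtaDefs              -- ★ p857893: `etaTwoSet`, `etaTwoIntegrand`, `etaTwo`
import HarnessLib

/-!
# Crux `HLiu418`, ROAD Φ, organ Φ6b-6 — DEFS leaf: the β-shifted `η` and `Ξ` on `Herm₂(ℂ)`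

Cell `hodgecm-mathlib`, crux item hLiu418 = `stmt-HodgeConjecture-24832`, route of record `HCCMUnconditional`; squad K2, LEAD F0P6-plan (g12)
(«= GO the first-order vehicle» 2026-09-04 07:40:27Z), co-dealer K2E5-plan (g6) («=» 07:41:05Z), prover K2E5-p16 (g5).
DEFINITIONS WITH BODIES + `rfl`∕algebraic API (no instance, no notation, no named-fact hypothesis, no `sorry`); lane `--supports stmt-HodgeConjecture-24832
--as helper` (count-neutral; definitions ⇒ review lane).

THE OBJECTS.  For `g, h ∈ Herm₂(ℂ)`, `(α, β) ∈ ℂ²`, in the chart `x = hermTwo c = [[a, z],[z̄, b]]` (Lean indices `0, 1`):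
* `etaShiftWeight g h α c = (g₀₀ − (α − 2)·(x + h)₁₁ ∕ det(x + h)) ∕ (x − h)₁₁` — the weight produced by ONE integration by parts in the
  coordinate `a = x₀₀` (`∂_a det(x − h) = (x − h)₁₁`, `∂_a tr(g x) = g₀₀`, `∂_a det(x + h) = (x + h)₁₁`);
* `etaShiftIntegrand g h α β c = etaShiftWeight g h α c · etaTwoIntegrand g h α (β + 1) c`
  `= Q_α(x) · e^{−tr(gx)} det(x + h)^{α−2} det(x − h)^{β−1}` — the power of `det(x − h)` RAISED BY ONE;
* `etaShift g h α β = ∫_{x ± h > 0} etaShiftIntegrand` — THE β-SHIFTED `η`: it equals `(β − 1)·η(g, h; α, β)` for `g, h > 0`, `re β > 1`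
  (★-to-be `K2LiuHermTwoEtaBetaShift`) and converges absolutely, holomorphically along complex lines in `(α, β)`, on `ℂ × {re β > 0}`
  (★-to-be `K2LiuHermTwoEtaShiftConvergence` ∕ `…Holomorphy`) [Shimura1982, §3: one step of the continuation of Thm 3.1, Case II, m = 2];
* `xiShift g h α β = 4π⁴ e^{iπ(β−α)} Γ₂(α)⁻¹ · (π Γ(β)²)⁻¹ · etaShift(2g, πh; α, β)` — THE β-SHIFTED `Ξ`: since `(β − 1)Γ₂(β) = π Γ(β)²`
  (`Γ₂(β) = π Γ(β) Γ(β−1)`), it equals the continuation `Ξ(g, h; α, β) = 4π⁴ e^{iπ(β−α)} Γ₂(α)⁻¹ Γ₂(β)⁻¹ η(2g, πh; α, β)` of `ξ` wherever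
  `re β > 1`, and is the vehicle of `Ξ` on `ℂ × {re β > 0}` (`Γ(β)⁻¹` is entire) (★-to-be `K2LiuHermTwoXiBetaShift`).
API: unfolding lemmas, the weight∕integrand in coordinates, measurability.
HONEST LABEL.  Count-neutral DEFS leaf; it pays nothing by itself: `HC_CM` is proved only modulo the 7 printed citations (2 remaining named inputs:
hLiu418 = `stmt-HodgeConjecture-24832`, h413 = `stmt-HodgeConjecture-24833`) until rung 0 closes.
-/

set_option autoImplicit false
-- the mandated namespace repeats the single-problem summit's segment (`HodgeConjecture.HodgeConjecture`)
set_option linter.dupNamespace false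

noncomputable section

open Complex MeasureTheory Set
open scoped ComplexOrder ComplexConjugate

namespace Summit.HodgeConjecture.HodgeConjecture.Cruxes.HLiu418.K2LiuHermTwoEtaShiftDefs

open Summit.HodgeConjecture.HodgeConjecture.Cruxes.HLiu418.K2LiuHermTwoGammaDefs
open Summit.HodgeConjecture.HodgeConjecture.Cruxes.HLiu418.K2LiuHermTwoEtaDefs

/-! ## The weight, the shifted integrand, the shifted `η`, the shifted `Ξ` -/

/-- THE WEIGHT OF THE β-SHIFT: `Q_α(x) = (g₀₀ − (α − 2)·(x + h)₁₁ ∕ det(x + h)) ∕ (x − h)₁₁` in the chart `x = hermTwo c`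
(the coordinate weight produced by one integration by parts in `a = x₀₀`). -/
def etaShiftWeight (g h : Matrix (Fin 2) (Fin 2) ℂ) (α : ℂ) (c : ℝ × ℂ × ℝ) : ℂ :=
  (g 0 0 - (α - 2) * ((hermTwo c + h) 1 1 / (hermTwo c + h).det)) / (hermTwo c - h) 1 1

/-- THE β-SHIFTED INTEGRAND: `Q_α(x) · e^{−tr(gx)} det(x + h)^{α−2} det(x − h)^{(β+1)−2}` — the `η`-integrand at `(α, β + 1)` times the weight. -/
def etaShiftIntegrand (g h : Matrix (Fin 2) (Fin 2) ℂ) (α β : ℂ) (c : ℝ × ℂ × ℝ) : ℂ :=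
  etaShiftWeight g h α c * etaTwoIntegrand g h α (β + 1) c

/-- THE β-SHIFTED `η`: `etaShift g h α β = ∫_{x ± h > 0} Q_α(x) e^{−tr(gx)} det(x + h)^{α−2} det(x − h)^{β−1} dx` (Bochner integral over the
chart).  For `g, h > 0` it equals `(β − 1)·η(g, h; α, β)` when `re β > 1` and converges absolutely for `re β > 0` (sequel files). -/
def etaShift (g h : Matrix (Fin 2) (Fin 2) ℂ) (α β : ℂ) : ℂ :=
  ∫ c in etaTwoSet h, etaShiftIntegrand g h α β c

/-- THE β-SHIFTED `Ξ`: `xiShift g h α β = 4π⁴ · e^{iπ(β−α)} · Γ₂(α)⁻¹ · (π Γ(β)²)⁻¹ · etaShift(2g, πh; α, β)`.  Because `(β − 1)·Γ₂(β) = π Γ(β)²`,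
for `re β > 1` this IS `Ξ(g, h; α, β) = 4π⁴ e^{iπ(β−α)} Γ₂(α)⁻¹ Γ₂(β)⁻¹ η(2g, πh; α, β)` (the continuation of Shimura's `ξ`), and it carries `Ξ`
to `ℂ × {re β > 0}` (sequel files). -/
def xiShift (g h : Matrix (Fin 2) (Fin 2) ℂ) (α β : ℂ) : ℂ :=
  ((4 * Real.pi ^ 4 : ℝ) : ℂ) * cexp ((Real.pi * I) * (β - α)) * (hermTwoGamma α)⁻¹ * ((Real.pi : ℂ) * Complex.Gamma β ^ 2)⁻¹ *
    etaShift ((2 : ℂ) • g) ((Real.pi : ℂ) • h) α β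

/-! ## Unfolding lemmas -/

/-- Unfolding lemma for the weight. -/
theorem etaShiftWeight_apply (g h : Matrix (Fin 2) (Fin 2) ℂ) (α : ℂ) (c : ℝ × ℂ × ℝ) :
    etaShiftWeight g h α c = (g 0 0 - (α - 2) * ((hermTwo c + h) 1 1 / (hermTwo c + h).det)) / (hermTwo c - h) 1 1 := rfl

/-- Unfolding lemma for the shifted integrand. -/
theorem etaShiftIntegrand_apply (g h : Matrix (Fin 2) (Fin 2) ℂ) (α β : ℂ) (c : ℝ × ℂ × ℝ) :
    etaShiftIntegrand g h α β c = etaShiftWeight g h α c * etaTwoIntegrand g h α (β + 1) c := rfl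

/-- The shifted integrand, fully spelled out. -/
theorem etaShiftIntegrand_eq (g h : Matrix (Fin 2) (Fin 2) ℂ) (α β : ℂ) (c : ℝ × ℂ × ℝ) :
    etaShiftIntegrand g h α β c =
      (g 0 0 - (α - 2) * ((hermTwo c + h) 1 1 / (hermTwo c + h).det)) / (hermTwo c - h) 1 1 *
        (cexp (-(hermTwo c * g).trace) * ((hermTwo c + h).det ^ (α - 2) * (hermTwo c - h).det ^ (β + 1 - 2))) := rfl

/-- Unfolding lemma for the shifted `η`. -/
theorem etaShift_def (g h : Matrix (Fin 2) (Fin 2) ℂ) (α β : ℂ) :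
    etaShift g h α β = ∫ c in etaTwoSet h, etaShiftIntegrand g h α β c := rfl

/-- Unfolding lemma for the shifted `Ξ`. -/
theorem xiShift_def (g h : Matrix (Fin 2) (Fin 2) ℂ) (α β : ℂ) :
    xiShift g h α β = ((4 * Real.pi ^ 4 : ℝ) : ℂ) * cexp ((Real.pi * I) * (β - α)) * (hermTwoGamma α)⁻¹ *
      ((Real.pi : ℂ) * Complex.Gamma β ^ 2)⁻¹ * etaShift ((2 : ℂ) • g) ((Real.pi : ℂ) • h) α β := rfl

/-- The exponent bookkeeping `(β + 1) − 2 = β − 1`. -/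
theorem shift_exponent (β : ℂ) : β + 1 - 2 = β - 1 := by ring

/-! ## The weight in coordinates -/

/-- The `(1,1)` entry of `x + h` in the chart: `b + h₁₁`. -/
theorem hermTwo_add_apply_one_one (h : Matrix (Fin 2) (Fin 2) ℂ) (c : ℝ × ℂ × ℝ) : (hermTwo c + h) 1 1 = (c.2.2 : ℂ) + h 1 1 := by
  simp [hermTwo]

/-- The `(1,1)` entry of `x − h` in the chart: `b − h₁₁`. -/
theorem hermTwo_sub_apply_one_one (h : Matrix (Fin 2) (Fin 2) ℂ) (c : ℝ × ℂ × ℝ) : (hermTwo c - h) 1 1 = (c.2.2 : ℂ) - h 1 1 := by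
  simp [hermTwo]

/-- For Hermitian `h = hermTwo e` the weight reads, in coordinates,
`Q_α(a, z, b) = (g₀₀ − (α − 2)(b + e₃) ∕ ((a + e₁)(b + e₃) − |z + e₂|²)) ∕ (b − e₃)`. -/
theorem etaShiftWeight_hermTwo (g : Matrix (Fin 2) (Fin 2) ℂ) (e : ℝ × ℂ × ℝ) (α : ℂ) (c : ℝ × ℂ × ℝ) :
    etaShiftWeight g (hermTwo e) α c =
      (g 0 0 - (α - 2) * (((c.2.2 + e.2.2 : ℝ) : ℂ) / (((c.1 + e.1) * (c.2.2 + e.2.2) - normSq (c.2.1 + e.2.1) : ℝ) : ℂ))) /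
        ((c.2.2 - e.2.2 : ℝ) : ℂ) := by
  rw [etaShiftWeight_apply, ← hermTwo_add, ← hermTwo_sub, det_hermTwo, hermTwo_apply_one_one, hermTwo_apply_one_one]
  simp

/-! ## Measurability -/

/-- The weight is measurable. -/
theorem measurable_etaShiftWeight (g h : Matrix (Fin 2) (Fin 2) ℂ) (α : ℂ) : Measurable (etaShiftWeight g h α) := by
  unfold etaShiftWeight
  have h11 : Measurable fun c : ℝ × ℂ × ℝ => (hermTwo c + h) 1 1 := by
    simp_rw [hermTwo_add_apply_one_one]
    fun_prop
  have h11' : Measurable fun c : ℝ × ℂ × ℝ => (hermTwo c - h) 1 1 := by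
    simp_rw [hermTwo_sub_apply_one_one]
    fun_prop
  exact ((measurable_const.sub (measurable_const.mul (h11.div (continuous_det_hermTwo_add h).measurable))).div h11')

/-- The shifted integrand is measurable. -/
theorem measurable_etaShiftIntegrand (g h : Matrix (Fin 2) (Fin 2) ℂ) (α β : ℂ) : Measurable (etaShiftIntegrand g h α β) :=
  (measurable_etaShiftWeight g h α).mul (measurable_etaTwoIntegrand g h α (β + 1))

/-- The shifted integrand is a.e.-strongly measurable for any restricted measure. -/
theorem aestronglyMeasurable_etaShiftIntegrand (g h : Matrix (Fin 2) (Fin 2) ℂ) (α β : ℂ) (S : Set (ℝ × ℂ × ℝ)) :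
    AEStronglyMeasurable (etaShiftIntegrand g h α β) ((volume : Measure (ℝ × ℂ × ℝ)).restrict S) :=
  (measurable_etaShiftIntegrand g h α β).aestronglyMeasurable

end Summit.HodgeConjecture.HodgeConjecture.Cruxes.HLiu418.K2LiuHermTwoEtaShiftDefs

end
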